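import Literature.MathematicalPhysics.QuantumLattice.HubbardFreePropagator
import HarnessLib

/-!
# Momentum-mode fermions and the reduced BCS (Richardson) pairing Hamiltonian on the torus

Topic `MathematicalPhysics/QuantumLattice`. The finite-dimensional objects "below the gap scale"
of the weak-coupling BCS analyses of the Hubbard torus (route `BcsKacWindow`, crux
`CoherenceWindowLRO`; cards `bcs-deformation-ladder`, `kac-range-preformed-pairs-theorem`), on the
SAME Fock space `Fock (Orb (FermionTorus d L))` as `hubbardTorus d L t U`:

* `momentumAnnihilation k σ = c_{kσ} = L^{-d/2} Σ_x conj χ_k(x) c_{xσ}` (`χ_k = torusChar k`,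
  `L^{-d/2} = torusFourierWeight d L`), `momentumCreation = (·)ᴴ`, `momentumNumber = c†c`: the
  Bloch modes of the fermionic torus `(ℤ/Lℤ)^d`, UNITARILY normalised (the request's literal
  formula `Σ_x conj (planeWave k σ (orb x σ)) • annihilation (orb x σ)` omits the factor `L^{-d/2}`;
  with it `{c_{kσ}, c†_{k'σ'}} = δδ` and `n_{kσ}` is an occupation number, as the requested
  identity `H₀ = Σ_k ε_L(k) n_{kσ}` presupposes). PROVED: the CAR in momentum space
  (`momentumAnnihilation_anticomm`, `momentumAnnihilation_mul_momentumCreation_add`), Fourier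
  inversion (`annihilation_orb_eq_sum_momentumAnnihilation`), `N = Σ_{kσ} n_{kσ}`
  (`totalNumber_eq_sum_momentumNumber`) and the diagonalisation of the free torus Hubbard
  Hamiltonian, `hubbardTorusWith d L 1 0 μ = Σ_{kσ} (ε_L(k) - μ) n_{kσ}` for `L ≥ 3`
  (`hubbardTorusWith_zero_eq_sum_momentumNumber`; `torusBand L k = -2Σᵢcos(2πkᵢ/L)`), via the
  plane-wave eigenvectors of `HubbardFreePropagator` and `H - μN = dΓ(h)` of `FermionQuasiFree`.
* `pairMode k = b_k = c_{-k↓} c_{k↑}`, `pairOperator ĝ S = B(ĝ,S) = Σ_{k∈S} ĝ(k) b_k`, the shell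
  `torusEnergyShell d L μ Λ = {k : |ε_L(k) - μ| ≤ Λ}`, form factors `sWaveGap ≡ 1`,
  `dWaveGap k = cos k₁ - cos k₂`, and
  **`reducedBCSTorus μ ĝ S g = Σ_{k,σ} (ε_L(k) - μ) n_{kσ} - (g/L^d) B(ĝ,S)ᴴ B(ĝ,S)`**, the reduced
  BCS / pairing-force Hamiltonian (von Delft–Ralph 2001 §4.2.1 for `ĝ ≡ 1`; separable `d`-wave
  form factor as in Scalapino 1995 §2). PROVED: Hermitian (`isHermitian_reducedBCSTorus`),
  `[N, H] = 0`, `[S^z, H] = 0` (`commute_totalNumber_reducedBCSTorus`,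
  `commute_spinZ_reducedBCSTorus`, through the spin-weighted charges `spinWeightedNumber f`, all of
  which are conserved), the hard-core boson relations of von Delft–Ralph §4.2.3 in the full Fock
  space (`pairMode_mul_self`, `pairMode_comm`, `pairMode_commutator_conjTranspose`:
  `[b_k, b†_{k'}] = δ_{kk'}(1 - n_{k↑} - n_{-k↓})`, `pairNumber_commutator_conjTranspose`:
  `[b†_k b_k, b†_{k'}] = δ_{kk'} b†_k`).
* Richardson's exact solution of the level-independent model (Richardson 1963; von Delft–Ralph
  §5.1.1) as a NAMED FACT, statement only: `richardsonHamiltonian ε U G = Σ_{i,j∈U}(2ε_jδ_{ij} - G)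
  b†_i b_j`, `richardsonPairCreator ε U E = Σ_{j∈U} b†_j/(2ε_j - E)`, `IsRichardsonSolution`
  (Richardson's equations) and `richardson_exact_eigenstates d L : Prop`.

## Design notes

* `d, L` are implicit in the operators (read off `k : TorusSite d L` / `S : Finset (TorusSite d L)`),
  `[NeZero L]` throughout (`torusChar` needs it); `torusFourierWeight d L = (√(L^d))⁻¹ : ℂ`
  (`= L⁻¹` for `d = 2`, `torusFourierWeight_two`).
* Operators on the concrete orbital type `Orb (FermionTorus d L)` meet two `DecidableEq` instance
  paths (concrete `instDecidableEqLex …` vs the generic lemmas' `LinearOrder.toDecidableEq`, equal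
  by `Subsingleton.elim` only); the one junction (the unit matrix of the CAR) is bridged once in
  `annihilation_mul_creation_add_torus`, and no statement here mentions `Matrix.diagonal`.
* Not here: the seniority/blocking reduction of `reducedBCSTorus` to `richardsonHamiltonian` on
  pair states, the BCS/Bogoliubov mean-field theory, number projection, parity gaps.

## Mathlib / tree search

Mathlib has no CAR algebra / second quantisation / BCS model (`lean search
'momentumAnnihilation|pairOperator|reducedBCS|richardson'`: nothing). Tree: `annihilation`,
`creation`, CAR discharges (`FermionOperatorsProofs`), `dGamma`, `hamiltonianWith_zero_eq_dGamma`
(`FermionQuasiFree`), `planeWave`, `torusBand`, `hubbardOneBody_mulVec_planeWave`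
(`HubbardFreePropagator`), `torusChar`, `sum_torusChar_left/right` (`TorusFourierProofs`),
`hubbardTorusWith`, `FermionTorus.equivTorusSite` (`HubbardModel`), `pairField`,
`dWaveFormFactor` (position-space `d`-wave pair field, `PairCorrelations`).

## References

* J. von Delft, D. C. Ralph, *Spectroscopy of discrete energy levels in ultrasmall metallic
  grains*, Phys. Rep. 345 (2001) 61–173 = arXiv:cond-mat/0101019: §4.2.1 (the reduced BCS
  Hamiltonian `Ĥ = Σ_{jσ}(ε_j - μ - σh)c†_{jσ}c_{jσ} - λd Σ_{ij} c†_{i+}c†_{i-}c_{j-}c_{j+}`),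
  §4.2.3 (`[Ĥ, N̂] = 0`, blocking, `Ĥ_U = Σ_{ij}[2(ε_j - μ)δ_{ij} - λd] b†_i b_j`, hard-core boson
  relations), §5.1.1 (Richardson's exact solution). [VondelftRalph2001]
* R. W. Richardson, *A restricted class of exact eigenstates of the pairing-force Hamiltonian*,
  Phys. Lett. 3 (1963) 277–279. [Richardson1963]
* G. Benfatto, A. Giuliani, V. Mastropietro, Ann. Henri Poincaré 7 (2006) 809, §1.2, §2.1
  (momentum modes, free propagator). [BenfattoGiulianiMastropietro2006]
* D. J. Scalapino, Phys. Rep. 250 (1995) 329, §2 (`d_{x²-y²}` form factor). [Scalapino1995]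
-/

noncomputable section

open Matrix Finset
open Literature.Probability.LatticeModels
open scoped ComplexConjugate

namespace Literature.MathematicalPhysics.QuantumLattice

/-! ### The unitary Fourier normalisation `L^{-d/2}` -/

section Weight

variable {d L : ℕ}

/-- The unitary Fourier normalisation `L^{-d/2} = 1/√(L^d)` of the discrete torus `(ℤ/Lℤ)^d`,
as a complex number. Friedli–Velenik 2017, §10.4. [folklore] -/
def torusFourierWeight (d L : ℕ) : ℂ := ((Real.sqrt ((L : ℝ) ^ d))⁻¹ : ℝ)

/-- `L^{-d/2} · L^{-d/2} = L^{-d}`. [folklore] -/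
theorem torusFourierWeight_mul_self :
    torusFourierWeight d L * torusFourierWeight d L = ((L : ℂ) ^ d)⁻¹ := by
  unfold torusFourierWeight
  rw [← Complex.ofReal_mul, ← mul_inv, Real.mul_self_sqrt (by positivity)]
  push_cast
  rfl

/-- The weight is real: `conj L^{-d/2} = L^{-d/2}`. [folklore] -/
@[simp] theorem star_torusFourierWeight : star (torusFourierWeight d L) = torusFourierWeight d L :=
  Complex.conj_ofReal _

/-- `L^{-d/2} · L^{-d/2} · L^d = 1` (`L ≠ 0`). [folklore] -/
theorem torusFourierWeight_mul_self_mul_pow [NeZero L] :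
    torusFourierWeight d L * torusFourierWeight d L * (L : ℂ) ^ d = 1 := by
  rw [torusFourierWeight_mul_self, inv_mul_cancel₀ natCast_pow_ne_zero]

/-- In two dimensions the weight is `1/L`. [folklore] -/
theorem torusFourierWeight_two : torusFourierWeight 2 L = (L : ℂ)⁻¹ := by
  unfold torusFourierWeight
  rw [Real.sqrt_sq (Nat.cast_nonneg L)]
  push_cast
  rfl

end Weight

/-! ### Momentum-mode creation and annihilation operators -/

section Momentum

variable {d L : ℕ} [NeZero L]

/-- The annihilation operator of the Bloch mode of momentum `k ∈ (ℤ/Lℤ)^d` and spin `σ` on the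
fermionic torus, unitarily normalised: `c_{kσ} = L^{-d/2} Σ_x conj χ_k(x) c_{xσ}`,
`χ_k(x) = e^{2πi k·x/L}` (so that `{c_{kσ}, c†_{k'σ'}} = δ_{kk'}δ_{σσ'}`,
`momentumAnnihilation_mul_momentumCreation_add`). The coefficient is `L^{-d/2} conj (planeWave k σ)`
(`momentumAnnihilation_eq_sum_planeWave`). Benfatto–Giuliani–Mastropietro 2006, §2.1 (Fourier modes
of the lattice fermion field); von Delft–Ralph 2001, §4.2.1 (the levels `c_{jσ}`). [folklore] -/
def momentumAnnihilation (k : TorusSite d L) (σ : Fin 2) :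
    Matrix (Finset (Orb (FermionTorus d L))) (Finset (Orb (FermionTorus d L))) ℂ :=
  ∑ x : FermionTorus d L,
    (torusFourierWeight d L * conj (torusChar k x.toTorusSite)) • annihilation (orb x σ)

/-- The creation operator of the Bloch mode `(k, σ)`: `c†_{kσ} = (c_{kσ})ᴴ = L^{-d/2} Σ_x χ_k(x) c†_{xσ}`.
[folklore] -/
def momentumCreation (k : TorusSite d L) (σ : Fin 2) :
    Matrix (Finset (Orb (FermionTorus d L))) (Finset (Orb (FermionTorus d L))) ℂ :=
  (momentumAnnihilation k σ)ᴴ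

/-- The occupation number of the Bloch mode `(k, σ)`: `n_{kσ} = c†_{kσ} c_{kσ}`. [folklore] -/
def momentumNumber (k : TorusSite d L) (σ : Fin 2) :
    Matrix (Finset (Orb (FermionTorus d L))) (Finset (Orb (FermionTorus d L))) ℂ :=
  momentumCreation k σ * momentumAnnihilation k σ

/-- `(c_{kσ})ᴴ = c†_{kσ}` (definitional). [folklore] -/
theorem momentumAnnihilation_conjTranspose (k : TorusSite d L) (σ : Fin 2) :
    (momentumAnnihilation k σ)ᴴ = momentumCreation k σ := rfl

/-- `(c†_{kσ})ᴴ = c_{kσ}`. [folklore] -/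
@[simp] theorem momentumCreation_conjTranspose (k : TorusSite d L) (σ : Fin 2) :
    (momentumCreation k σ)ᴴ = momentumAnnihilation k σ :=
  conjTranspose_conjTranspose _

/-- `c†_{kσ} = L^{-d/2} Σ_x χ_k(x) c†_{xσ}`. [folklore] -/
theorem momentumCreation_eq_sum (k : TorusSite d L) (σ : Fin 2) :
    momentumCreation k σ = ∑ x : FermionTorus d L,
      (torusFourierWeight d L * torusChar k x.toTorusSite) • creation (orb x σ) := by
  simp only [momentumCreation, momentumAnnihilation, conjTranspose_sum, conjTranspose_smul,
    annihilation_conjTranspose, star_mul', star_torusFourierWeight, Complex.star_def,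
    Complex.conj_conj]

/-- `n_{kσ}` is Hermitian. [folklore] -/
theorem momentumNumber_conjTranspose (k : TorusSite d L) (σ : Fin 2) :
    (momentumNumber k σ)ᴴ = momentumNumber k σ := by
  rw [momentumNumber, conjTranspose_mul, momentumCreation_conjTranspose,
    momentumAnnihilation_conjTranspose]

/-- `c_{kσ}` against the plane waves of `HubbardFreePropagator`: summing over ALL orbitals,
`c_{kσ} = Σ_o L^{-d/2} conj (planeWave k σ o) c_o` (the plane wave vanishes on the other spin).
[folklore] -/
theorem momentumAnnihilation_eq_sum_planeWave (k : TorusSite d L) (σ : Fin 2) :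
    momentumAnnihilation k σ = ∑ o : Orb (FermionTorus d L),
      (torusFourierWeight d L * conj (planeWave k σ o)) • annihilation o := by
  have hre : ∀ f : Orb (FermionTorus d L) → Matrix (Finset (Orb (FermionTorus d L)))
      (Finset (Orb (FermionTorus d L))) ℂ,
      ∑ o, f o = ∑ x : FermionTorus d L, ∑ τ : Fin 2, f (orb x τ) := fun f => by
    rw [← Fintype.sum_prod_type', ← (toLex : FermionTorus d L × Fin 2 ≃ _).sum_comp]
  rw [hre]
  unfold momentumAnnihilation
  refine Finset.sum_congr rfl fun x _ => ?_
  simp only [planeWave_orb, apply_ite (starRingEnd ℂ), map_zero, mul_ite, mul_zero, ite_smul,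
    zero_smul, Finset.sum_ite_eq', Finset.mem_univ, if_true]

/-- `c†_{kσ} = Σ_o L^{-d/2} (planeWave k σ o) c†_o`. [folklore] -/
theorem momentumCreation_eq_sum_planeWave (k : TorusSite d L) (σ : Fin 2) :
    momentumCreation k σ = ∑ o : Orb (FermionTorus d L),
      (torusFourierWeight d L * planeWave k σ o) • creation o := by
  rw [momentumCreation, momentumAnnihilation_eq_sum_planeWave]
  simp only [conjTranspose_sum, conjTranspose_smul, annihilation_conjTranspose, star_mul',
    star_torusFourierWeight, Complex.star_def, Complex.conj_conj]

/-! ### Completeness of the characters and the canonical anticommutation relations -/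

/-- Completeness of the normalised characters on the fermionic torus:
`Σ_k L^{-d/2} χ_k(x) · L^{-d/2} conj χ_k(y) = δ_{xy}` (orthogonality `sum_torusChar_left`).
Friedli–Velenik 2017, §10.4. [folklore] -/
theorem sum_torusFourierWeight_mul_torusChar_mul_conj (x y : FermionTorus d L) :
    ∑ k : TorusSite d L, torusFourierWeight d L * torusChar k x.toTorusSite *
        (torusFourierWeight d L * conj (torusChar k y.toTorusSite)) =
      if x = y then 1 else 0 := by
  have h := sum_torusChar_left (x.toTorusSite - y.toTorusSite)
  simp only [torusChar_sub_right] at h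
  have hinj : x.toTorusSite = y.toTorusSite ↔ x = y :=
    (FermionTorus.equivTorusSite (d := d) (L := L)).injective.eq_iff
  calc _ = torusFourierWeight d L * torusFourierWeight d L *
        ∑ k : TorusSite d L, torusChar k x.toTorusSite * conj (torusChar k y.toTorusSite) := by
        rw [Finset.mul_sum]
        exact Finset.sum_congr rfl fun k _ => by ring
    _ = _ := by
        rw [h]
        simp only [sub_eq_zero, hinj]
        split_ifs
        · exact torusFourierWeight_mul_self_mul_pow
        · exact mul_zero _

omit [NeZero L] in
/-- The position-space mixed CAR on the fermionic torus, `c_o c†_{o'} + c†_{o'} c_o = δ_{oo'}`,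
restated with the `DecidableEq` instance that instance resolution finds on the concrete type
`Orb (FermionTorus d L)` (the generic lemma carries `LinearOrder.toDecidableEq`; the two agree by
`Subsingleton.elim`, not definitionally). [folklore] -/
theorem annihilation_mul_creation_add_torus (o o' : Orb (FermionTorus d L)) :
    annihilation o * creation o' + creation o' * annihilation o = if o = o' then 1 else 0 := by
  convert annihilation_mul_creation_add_creation_mul_annihilation_holds o o'

/-- **Pure CAR in momentum space**: `c_{kσ} c_{k'σ'} + c_{k'σ'} c_{kσ} = 0`.
Bratteli–Robinson II §5.2.1 (the CAR for `a(f)`, `a(g)` with orthonormal `f, g`). [folklore] -/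
theorem momentumAnnihilation_anticomm (k k' : TorusSite d L) (σ σ' : Fin 2) :
    momentumAnnihilation k σ * momentumAnnihilation k' σ' +
      momentumAnnihilation k' σ' * momentumAnnihilation k σ = 0 := by
  unfold momentumAnnihilation
  rw [Finset.sum_mul_sum, Finset.sum_mul_sum]
  conv_lhs => arg 2; rw [Finset.sum_comm]
  rw [← Finset.sum_add_distrib]
  refine Finset.sum_eq_zero fun x _ => ?_
  rw [← Finset.sum_add_distrib]
  refine Finset.sum_eq_zero fun y _ => ?_
  rw [smul_mul_smul_comm, smul_mul_smul_comm, mul_comm (torusFourierWeight d L * _)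
    (torusFourierWeight d L * conj (torusChar k x.toTorusSite)), ← smul_add,
    annihilation_anticommute_holds, smul_zero]

/-- **Mixed CAR in momentum space**: `c_{kσ} c†_{k'σ'} + c†_{k'σ'} c_{kσ} = δ_{kk'} δ_{σσ'}`
(position-space CAR and the orthonormality `L^{-d} Σ_x χ_{k'}(x) conj χ_k(x) = δ_{kk'}`).
Bratteli–Robinson II §5.2.1; BGM 2006 §2.1. [folklore] -/
theorem momentumAnnihilation_mul_momentumCreation_add (k k' : TorusSite d L) (σ σ' : Fin 2) :
    momentumAnnihilation k σ * momentumCreation k' σ' +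
        momentumCreation k' σ' * momentumAnnihilation k σ =
      if k = k' ∧ σ = σ' then 1 else 0 := by
  rw [momentumCreation_eq_sum]
  unfold momentumAnnihilation
  rw [Finset.sum_mul_sum, Finset.sum_mul_sum]
  conv_lhs => arg 2; rw [Finset.sum_comm]
  rw [← Finset.sum_add_distrib]
  have hxy : ∀ x y : FermionTorus d L,
      (torusFourierWeight d L * conj (torusChar k x.toTorusSite)) • annihilation (orb x σ) *
          ((torusFourierWeight d L * torusChar k' y.toTorusSite) • creation (orb y σ')) +
        (torusFourierWeight d L * torusChar k' y.toTorusSite) • creation (orb y σ') *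
          ((torusFourierWeight d L * conj (torusChar k x.toTorusSite)) • annihilation (orb x σ)) =
      if x = y then (if σ = σ' then (torusFourierWeight d L * torusChar k' x.toTorusSite *
        (torusFourierWeight d L * conj (torusChar k x.toTorusSite))) • 1 else 0) else 0 := by
    intro x y
    rw [smul_mul_smul_comm, smul_mul_smul_comm, mul_comm (torusFourierWeight d L * conj _)
      (torusFourierWeight d L * torusChar k' y.toTorusSite), ← smul_add,
      annihilation_mul_creation_add_torus]
    simp only [orb_eq_orb_iff]
    by_cases h : x = y
    · subst h
      by_cases hs : σ = σ' <;> simp [hs]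
    · simp [h]
  simp only [← Finset.sum_add_distrib, hxy, Finset.sum_ite_eq, Finset.mem_univ, if_true]
  by_cases hs : σ = σ'
  · simp only [hs, if_true, and_true, ← Finset.sum_smul]
    rw [FermionTorus.sum_eq_sum_torusSite]
    simp only [FermionTorus.toTorusSite_ofTorusSite]
    have hsum : ∑ z : TorusSite d L, torusFourierWeight d L * torusChar k' z *
        (torusFourierWeight d L * conj (torusChar k z)) = if k = k' then 1 else 0 := by
      have h := sum_torusChar_right (k' - k)
      simp only [torusChar_sub_left] at h
      calc _ = torusFourierWeight d L * torusFourierWeight d L *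
            ∑ z : TorusSite d L, torusChar k' z * conj (torusChar k z) := by
            rw [Finset.mul_sum]
            exact Finset.sum_congr rfl fun z _ => by ring
        _ = _ := by
            rw [h]
            simp only [sub_eq_zero, @eq_comm _ k' k]
            split_ifs
            · exact torusFourierWeight_mul_self_mul_pow
            · exact mul_zero _
    rw [hsum]
    split_ifs <;> simp
  · simp [hs]

/-- Normal ordering in momentum space: `c_{kσ} c†_{k'σ'} = δ_{kk'}δ_{σσ'} - c†_{k'σ'} c_{kσ}`.
[folklore] -/
theorem momentumAnnihilation_mul_momentumCreation (k k' : TorusSite d L) (σ σ' : Fin 2) :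
    momentumAnnihilation k σ * momentumCreation k' σ' =
      (if k = k' ∧ σ = σ' then 1 else 0) - momentumCreation k' σ' * momentumAnnihilation k σ :=
  eq_sub_of_add_eq (momentumAnnihilation_mul_momentumCreation_add k k' σ σ')

/-- `c_{kσ} c_{k'σ'} = - c_{k'σ'} c_{kσ}`. [folklore] -/
theorem momentumAnnihilation_mul_eq_neg (k k' : TorusSite d L) (σ σ' : Fin 2) :
    momentumAnnihilation k σ * momentumAnnihilation k' σ' =
      -(momentumAnnihilation k' σ' * momentumAnnihilation k σ) :=
  eq_neg_of_add_eq_zero_left (momentumAnnihilation_anticomm k k' σ σ')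

/-- `c†_{kσ} c†_{k'σ'} = - c†_{k'σ'} c†_{kσ}`. [folklore] -/
theorem momentumCreation_mul_eq_neg (k k' : TorusSite d L) (σ σ' : Fin 2) :
    momentumCreation k σ * momentumCreation k' σ' =
      -(momentumCreation k' σ' * momentumCreation k σ) := by
  have h := congrArg conjTranspose (momentumAnnihilation_mul_eq_neg k' k σ' σ)
  simpa only [conjTranspose_mul, conjTranspose_neg, momentumAnnihilation_conjTranspose] using h

/-- **Fourier inversion**: `c_{xσ} = L^{-d/2} Σ_k χ_k(x) c_{kσ}`. BGM 2006 §2.1;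
Friedli–Velenik 2017, §10.4. [folklore] -/
theorem annihilation_orb_eq_sum_momentumAnnihilation (x : FermionTorus d L) (σ : Fin 2) :
    annihilation (orb x σ) = ∑ k : TorusSite d L,
      (torusFourierWeight d L * torusChar k x.toTorusSite) • momentumAnnihilation k σ := by
  unfold momentumAnnihilation
  simp only [Finset.smul_sum, smul_smul]
  rw [Finset.sum_comm]
  simp only [← Finset.sum_smul, sum_torusFourierWeight_mul_torusChar_mul_conj, ite_smul, one_smul,
    zero_smul, Finset.sum_ite_eq, Finset.mem_univ, if_true]

/-- **Fourier inversion** for creation operators: `c†_{xσ} = L^{-d/2} Σ_k conj χ_k(x) c†_{kσ}`.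
[folklore] -/
theorem creation_orb_eq_sum_momentumCreation (x : FermionTorus d L) (σ : Fin 2) :
    creation (orb x σ) = ∑ k : TorusSite d L,
      (torusFourierWeight d L * conj (torusChar k x.toTorusSite)) • momentumCreation k σ := by
  have h := congrArg conjTranspose (annihilation_orb_eq_sum_momentumAnnihilation x σ)
  simpa only [annihilation_conjTranspose, conjTranspose_sum, conjTranspose_smul,
    momentumAnnihilation_conjTranspose, star_mul', star_torusFourierWeight, Complex.star_def] using h

/-! ### Completeness of the plane waves; particle number and kinetic energy in momentum space -/

/-- Completeness of the normalised plane waves on the orbitals of the fermionic torus: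
`Σ_{k,τ} L^{-d} (planeWave k τ o) conj (planeWave k τ o') = δ_{oo'}`. [folklore] -/
theorem sum_planeWave_mul_conj (o o' : Orb (FermionTorus d L)) :
    ∑ k : TorusSite d L, ∑ τ : Fin 2, torusFourierWeight d L * planeWave k τ o *
        (torusFourierWeight d L * conj (planeWave k τ o')) = if o = o' then 1 else 0 := by
  obtain ⟨⟨x, σ⟩, rfl⟩ : ∃ p : FermionTorus d L × Fin 2, toLex p = o := ⟨ofLex o, toLex_ofLex o⟩
  obtain ⟨⟨y, σ'⟩, rfl⟩ : ∃ p : FermionTorus d L × Fin 2, toLex p = o' :=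
    ⟨ofLex o', toLex_ofLex o'⟩
  change ∑ k : TorusSite d L, ∑ τ : Fin 2, torusFourierWeight d L * planeWave k τ (orb x σ) *
      (torusFourierWeight d L * conj (planeWave k τ (orb y σ'))) =
    if orb x σ = orb y σ' then 1 else 0
  have hτ : ∀ k : TorusSite d L, ∑ τ : Fin 2, torusFourierWeight d L * planeWave k τ (orb x σ) *
      (torusFourierWeight d L * conj (planeWave k τ (orb y σ'))) =
      if σ = σ' then torusFourierWeight d L * torusChar k x.toTorusSite *
        (torusFourierWeight d L * conj (torusChar k y.toTorusSite)) else 0 := by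
    intro k
    simp only [planeWave_orb, apply_ite (starRingEnd ℂ), map_zero, mul_ite, mul_zero, ite_mul,
      zero_mul, Finset.sum_ite_eq, Finset.mem_univ, if_true]
  simp only [hτ, orb_eq_orb_iff]
  by_cases h : σ = σ'
  · simp only [h, if_true, and_true, sum_torusFourierWeight_mul_torusChar_mul_conj]
  · simp [h]

/-- `n_{kτ}` is the second quantisation of the rank-one projection onto the plane wave `(k, τ)`:
`n_{kτ} = dΓ(|kτ⟩⟨kτ|) = Σ_{o,o'} L^{-d} (planeWave k τ o) conj (planeWave k τ o') c†_o c_{o'}`.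
Bratteli–Robinson II §5.2.1. [folklore] -/
theorem momentumNumber_eq_dGamma (k : TorusSite d L) (τ : Fin 2) :
    momentumNumber k τ = dGamma (Matrix.of fun o o' => torusFourierWeight d L * planeWave k τ o *
      (torusFourierWeight d L * conj (planeWave k τ o'))) := by
  rw [momentumNumber, momentumCreation_eq_sum_planeWave, momentumAnnihilation_eq_sum_planeWave,
    dGamma_eq, Finset.sum_mul_sum]
  refine Finset.sum_congr rfl fun o _ => Finset.sum_congr rfl fun o' _ => ?_
  rw [smul_mul_smul_comm, Matrix.of_apply]

/-- `dΓ` as a `ℂ`-linear map (from `dGamma_add`, `dGamma_smul`). Bratteli–Robinson II §5.2.1.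
[folklore] -/
def dGammaLinear {ι : Type*} [LinearOrder ι] [Fintype ι] :
    Matrix ι ι ℂ →ₗ[ℂ] Matrix (Finset ι) (Finset ι) ℂ where
  toFun := dGamma
  map_add' := dGamma_add
  map_smul' := dGamma_smul

/-- `dGammaLinear h = dGamma h`. [folklore] -/
@[simp] theorem dGammaLinear_apply {ι : Type*} [LinearOrder ι] [Fintype ι] (h : Matrix ι ι ℂ) :
    dGammaLinear h = dGamma h := rfl

/-- **The particle number in momentum space**: `N = Σ_{k,σ} n_{kσ}` (Parseval).
von Delft–Ralph 2001, §4.2.3 (`N̂ = Σ_{jσ} c†_{jσ} c_{jσ}`). [folklore] -/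
theorem totalNumber_eq_sum_momentumNumber :
    (totalNumber : Matrix (Finset (Orb (FermionTorus d L))) (Finset (Orb (FermionTorus d L))) ℂ) =
      ∑ k : TorusSite d L, ∑ σ : Fin 2, momentumNumber k σ := by
  have h1 : (totalNumber : Matrix (Finset (Orb (FermionTorus d L))) _ ℂ) =
      dGamma (Matrix.of fun o o' : Orb (FermionTorus d L) => if o = o' then (1 : ℂ) else 0) := by
    rw [← totalNumberOp_eq_totalNumber, totalNumberOp, dGamma_eq]
    refine Finset.sum_congr rfl fun o _ => ?_
    simp only [Matrix.of_apply, ite_smul, one_smul, zero_smul, Finset.sum_ite_eq, Finset.mem_univ,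
      if_true, numberAt]
  simp only [momentumNumber_eq_dGamma, ← dGammaLinear_apply, ← map_sum]
  rw [h1]
  congr 1
  ext o o'
  simp only [Matrix.sum_apply, Matrix.of_apply, sum_planeWave_mul_conj]

/-- **The free Hubbard Hamiltonian on the torus is diagonal in momentum space** (`L ≥ 3`):
`H(t=1, U=0) - μN = Σ_{k,σ} (ε_L(k) - μ) n_{kσ}` with the band `ε_L(k) = -2Σᵢ cos(2πkᵢ/L)`
(`torusBand`): plane waves are eigenvectors of the one-body matrix
(`hubbardOneBody_mulVec_planeWave`), they are complete (`sum_planeWave_mul_conj`), and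
`H - μN = dΓ(h)` (`hamiltonianWith_zero_eq_dGamma`). For `L ≤ 2` the torus graph degenerates and
the identity fails. BGM 2006 §1.2, eq. (1.4); von Delft–Ralph 2001, §4.2.1 (`Ĥ₀`).
[cite: BenfattoGiulianiMastropietro2006, eq. (1.4)] -/
theorem hubbardTorusWith_zero_eq_sum_momentumNumber (hL : 3 ≤ L) (μ : ℝ) :
    hubbardTorusWith d L 1 0 μ =
      ∑ k : TorusSite d L, ∑ σ : Fin 2, ((torusBand L k - μ : ℝ) : ℂ) • momentumNumber k σ := by
  rw [hubbardTorusWith, hamiltonianWith_zero_eq_dGamma]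
  set h := hubbardOneBody (fermionTorusGraph d L) 1 μ with hh
  -- matrix elements of `h` in the plane-wave basis
  have hel : ∀ o o', h o o' = ∑ k : TorusSite d L, ∑ τ : Fin 2, ((torusBand L k - μ : ℝ) : ℂ) *
      (torusFourierWeight d L * planeWave k τ o *
        (torusFourierWeight d L * conj (planeWave k τ o'))) := by
    intro o o'
    calc h o o' = ∑ o'', h o o'' * (if o'' = o' then 1 else 0) := by
          simp only [mul_ite, mul_one, mul_zero, Finset.sum_ite_eq', Finset.mem_univ, if_true]
      _ = ∑ o'', ∑ k : TorusSite d L, ∑ τ : Fin 2, h o o'' * (torusFourierWeight d L *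
            planeWave k τ o'' * (torusFourierWeight d L * conj (planeWave k τ o'))) := by
          simp only [← sum_planeWave_mul_conj, Finset.mul_sum]
      _ = ∑ k : TorusSite d L, ∑ τ : Fin 2, (torusFourierWeight d L *
            (torusFourierWeight d L * conj (planeWave k τ o'))) *
              (h *ᵥ planeWave k τ) o := by
          rw [Finset.sum_comm]
          refine Finset.sum_congr rfl fun k _ => ?_
          rw [Finset.sum_comm]
          refine Finset.sum_congr rfl fun τ _ => ?_
          simp only [Matrix.mulVec, dotProduct, Finset.mul_sum]
          exact Finset.sum_congr rfl fun o'' _ => by ring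
      _ = _ := by
          refine Finset.sum_congr rfl fun k _ => Finset.sum_congr rfl fun τ _ => ?_
          rw [hh, hubbardOneBody_mulVec_planeWave hL μ k τ, Pi.smul_apply, smul_eq_mul]
          ring
  have hmat : h = ∑ k : TorusSite d L, ∑ τ : Fin 2, ((torusBand L k - μ : ℝ) : ℂ) •
      Matrix.of fun o o' => torusFourierWeight d L * planeWave k τ o *
        (torusFourierWeight d L * conj (planeWave k τ o')) := by
    ext o o'
    simp only [hel, Matrix.sum_apply, Matrix.smul_apply, Matrix.of_apply, smul_eq_mul]
  simp only [momentumNumber_eq_dGamma, ← dGammaLinear_apply, ← map_smul, ← map_sum]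
  rw [hmat]

/-- At `μ = 0`: the free torus Hubbard Hamiltonian is `H(t=1, U=0) = Σ_{k,σ} ε_L(k) n_{kσ}`
(`L ≥ 3`). BGM 2006 §1.2. [folklore] -/
theorem hubbardTorus_zero_eq_sum_momentumNumber (hL : 3 ≤ L) :
    hubbardTorus d L 1 0 =
      ∑ k : TorusSite d L, ∑ σ : Fin 2, ((torusBand L k : ℝ) : ℂ) • momentumNumber k σ := by
  rw [← hubbardTorusWith_zero, hubbardTorusWith_zero_eq_sum_momentumNumber hL 0]
  simp only [sub_zero]

end Momentum

/-! ### Spin-weighted number operators: the charges `N` and `S^z` -/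

section Charges

variable {Λ : Type*} [LinearOrder Λ] [Fintype Λ]

/-- The spin-weighted number operator `Q_f = Σ_{x,σ} f(σ) n_{xσ}`: `f ≡ 1` gives the particle
number `N`, `f = (½, -½)` gives `S^z`. Tasaki 2020, §9.3. [folklore] -/
def spinWeightedNumber (f : Fin 2 → ℂ) : Matrix (Finset (Orb Λ)) (Finset (Orb Λ)) ℂ :=
  ∑ x : Λ, ∑ σ : Fin 2, f σ • numberOp x σ

/-- `N = Q_1`. [folklore] -/
theorem totalNumber_eq_spinWeightedNumber :
    (totalNumber : Matrix (Finset (Orb Λ)) _ ℂ) = spinWeightedNumber fun _ => 1 := by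
  simp [spinWeightedNumber, totalNumber]

/-- `S^z = Q_{(½,-½)}`. [folklore] -/
theorem spinZ_eq_spinWeightedNumber :
    (HubbardWave0.spinZ : Matrix (Finset (Orb Λ)) _ ℂ) =
      spinWeightedNumber ![1 / 2, -(1 / 2)] := by
  simp only [spinWeightedNumber, HubbardWave0.spinZ, Fin.sum_univ_two, Fin.isValue,
    Matrix.cons_val_zero, Matrix.cons_val_one, Finset.smul_sum, smul_add, smul_neg,
    sub_eq_add_neg, neg_smul]

/-- `[n_{yτ}, c†_{xσ}] = δ_{(y,τ),(x,σ)} c†_{xσ}`. Essler et al. 2005, §2.1 eq. (2.8). [folklore] -/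
theorem numberOp_commutator_creation (y x : Λ) (τ σ : Fin 2) :
    numberOp y τ * creation (orb x σ) - creation (orb x σ) * numberOp y τ =
      if σ = τ ∧ x = y then creation (orb x σ) else 0 := by
  by_cases h : orb y τ = orb x σ
  · obtain ⟨rfl, rfl⟩ := orb_eq_orb_iff.1 h
    rw [numberOp, number_mul_creation_self, creation_mul_number_self, sub_zero,
      if_pos ⟨rfl, rfl⟩]
  · rw [numberOp, number_mul_creation_of_ne h, sub_self, if_neg]
    rintro ⟨rfl, rfl⟩
    exact h rfl

/-- `[n_{yτ}, c_{xσ}] = -δ_{(y,τ),(x,σ)} c_{xσ}`. Essler et al. 2005, §2.1 eq. (2.8). [folklore] -/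
theorem numberOp_commutator_annihilation (y x : Λ) (τ σ : Fin 2) :
    numberOp y τ * annihilation (orb x σ) - annihilation (orb x σ) * numberOp y τ =
      -(if σ = τ ∧ x = y then annihilation (orb x σ) else 0) := by
  have h := congrArg conjTranspose (numberOp_commutator_creation y x τ σ)
  have hn : (numberOp y τ)ᴴ = numberOp y τ := (numberAt_isHermitian (orb y τ)).eq
  rw [conjTranspose_sub, conjTranspose_mul, conjTranspose_mul, creation_conjTranspose, hn] at h
  rw [← neg_sub, h]
  split_ifs
  · rw [creation_conjTranspose]
  · rw [conjTranspose_zero]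

/-- `[Q_f, c†_{xσ}] = f(σ) c†_{xσ}`. [folklore] -/
theorem spinWeightedNumber_commutator_creation (f : Fin 2 → ℂ) (x : Λ) (σ : Fin 2) :
    spinWeightedNumber f * creation (orb x σ) - creation (orb x σ) * spinWeightedNumber f =
      f σ • creation (orb x σ) := by
  simp only [spinWeightedNumber, Finset.sum_mul, Finset.mul_sum, smul_mul_assoc, mul_smul_comm,
    ← Finset.sum_sub_distrib, ← smul_sub, numberOp_commutator_creation, ite_and, smul_ite,
    smul_zero, Finset.sum_ite_eq, Finset.mem_univ, if_true]

/-- `[Q_f, c_{xσ}] = -f(σ) c_{xσ}`. [folklore] -/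
theorem spinWeightedNumber_commutator_annihilation (f : Fin 2 → ℂ) (x : Λ) (σ : Fin 2) :
    spinWeightedNumber f * annihilation (orb x σ) - annihilation (orb x σ) * spinWeightedNumber f =
      -(f σ • annihilation (orb x σ)) := by
  simp only [spinWeightedNumber, Finset.sum_mul, Finset.mul_sum, smul_mul_assoc, mul_smul_comm,
    ← Finset.sum_sub_distrib, ← smul_sub, numberOp_commutator_annihilation, ite_and, smul_neg,
    smul_ite, smul_zero, Finset.sum_neg_distrib, Finset.sum_ite_eq, Finset.mem_univ, if_true]

/-- The derivation rule `[Q, AB] = [Q, A]B + A[Q, B]`. [folklore] -/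
theorem commutator_mul_expand {n : Type*} [Fintype n] (Q A B : Matrix n n ℂ) :
    Q * (A * B) - A * B * Q = (Q * A - A * Q) * B + A * (Q * B - B * Q) := by
  noncomm_ring

end Charges

section MomentumCharges

variable {d L : ℕ} [NeZero L]

/-- `[Q_f, c†_{kσ}] = f(σ) c†_{kσ}`: a Bloch mode carries the same charges as a site orbital of
the same spin. [folklore] -/
theorem spinWeightedNumber_commutator_momentumCreation (f : Fin 2 → ℂ) (k : TorusSite d L)
    (σ : Fin 2) :
    spinWeightedNumber f * momentumCreation k σ - momentumCreation k σ * spinWeightedNumber f =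
      f σ • momentumCreation k σ := by
  rw [momentumCreation_eq_sum]
  simp only [Finset.mul_sum, Finset.sum_mul, mul_smul_comm, smul_mul_assoc,
    ← Finset.sum_sub_distrib, ← smul_sub, spinWeightedNumber_commutator_creation, Finset.smul_sum,
    smul_comm (f σ)]

/-- `[Q_f, c_{kσ}] = -f(σ) c_{kσ}`. [folklore] -/
theorem spinWeightedNumber_commutator_momentumAnnihilation (f : Fin 2 → ℂ) (k : TorusSite d L)
    (σ : Fin 2) :
    spinWeightedNumber f * momentumAnnihilation k σ -
        momentumAnnihilation k σ * spinWeightedNumber f = -(f σ • momentumAnnihilation k σ) := by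
  unfold momentumAnnihilation
  simp only [Finset.mul_sum, Finset.sum_mul, mul_smul_comm, smul_mul_assoc,
    ← Finset.sum_sub_distrib, ← smul_sub, spinWeightedNumber_commutator_annihilation, smul_neg,
    Finset.sum_neg_distrib, Finset.smul_sum, smul_comm (f σ)]

/-- `[Q_f, n_{kσ}] = 0`: the momentum occupation numbers conserve every spin-weighted charge.
[folklore] -/
theorem spinWeightedNumber_commute_momentumNumber (f : Fin 2 → ℂ) (k : TorusSite d L)
    (σ : Fin 2) : Commute (spinWeightedNumber f) (momentumNumber k σ) := by
  rw [Commute, SemiconjBy, ← sub_eq_zero, momentumNumber, commutator_mul_expand,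
    spinWeightedNumber_commutator_momentumCreation,
    spinWeightedNumber_commutator_momentumAnnihilation, smul_mul_assoc, mul_neg, mul_smul_comm,
    add_neg_cancel]

end MomentumCharges

/-! ### Pair operators and the reduced BCS Hamiltonian -/

section BCS

variable {d L : ℕ} [NeZero L]

/-- The pair annihilation operator of the time-reversed pair `(k↑, -k↓)`:
`b_k = c_{-k↓} c_{k↑}` (so `b†_k = c†_{k↑} c†_{-k↓}`). von Delft–Ralph 2001, §4.2.3
(`b_j = c_{j-} c_{j+}`, `b†_j = c†_{j+} c†_{j-}`). [cite: VondelftRalph2001, §4.2.3] -/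
def pairMode (k : TorusSite d L) :
    Matrix (Finset (Orb (FermionTorus d L))) (Finset (Orb (FermionTorus d L))) ℂ :=
  momentumAnnihilation (-k) 1 * momentumAnnihilation k 0

/-- `b†_k = c†_{k↑} c†_{-k↓}`. [folklore] -/
theorem pairMode_conjTranspose (k : TorusSite d L) :
    (pairMode k)ᴴ = momentumCreation k 0 * momentumCreation (-k) 1 := by
  rw [pairMode, conjTranspose_mul, momentumAnnihilation_conjTranspose,
    momentumAnnihilation_conjTranspose]

/-- The pair operator with form factor `ĝ` over the momentum shell `S`:
`B(ĝ, S) = Σ_{k ∈ S} ĝ(k) b_k = Σ_{k ∈ S} ĝ(k) c_{-k↓} c_{k↑}` (`ĝ ≡ 1`: the `s`-wave / reduced BCS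
pair operator of von Delft–Ralph 2001 §4.2.1; `ĝ(k) = cos k₁ - cos k₂`: the `d_{x²-y²}` channel,
Scalapino 1995 §2). [folklore] -/
def pairOperator (ĝ : TorusSite d L → ℝ) (S : Finset (TorusSite d L)) :
    Matrix (Finset (Orb (FermionTorus d L))) (Finset (Orb (FermionTorus d L))) ℂ :=
  ∑ k ∈ S, (ĝ k : ℂ) • pairMode k

/-- `B(ĝ, S)† = Σ_{k ∈ S} ĝ(k) c†_{k↑} c†_{-k↓}` (`ĝ` is real). [folklore] -/
theorem pairOperator_conjTranspose (ĝ : TorusSite d L → ℝ) (S : Finset (TorusSite d L)) :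
    (pairOperator ĝ S)ᴴ =
      ∑ k ∈ S, (ĝ k : ℂ) • (momentumCreation k 0 * momentumCreation (-k) 1) := by
  simp only [pairOperator, conjTranspose_sum, conjTranspose_smul, pairMode_conjTranspose,
    Complex.star_def, Complex.conj_ofReal]

/-- The energy shell of half-width `Λ` around the Fermi level:
`S = {k ∈ (ℤ/Lℤ)^d : |ε_L(k) - μ| ≤ Λ}` (von Delft–Ralph's set `I` of levels within the Debye
cutoff `|ε_j| < ω_D`, here closed). [cite: VondelftRalph2001, §4.2.1] -/
def torusEnergyShell (d L : ℕ) [NeZero L] (μ Λ : ℝ) : Finset (TorusSite d L) :=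
  univ.filter fun k => |torusBand L k - μ| ≤ Λ

/-- Membership in the energy shell. [folklore] -/
@[simp] theorem mem_torusEnergyShell {μ Λ : ℝ} {k : TorusSite d L} :
    k ∈ torusEnergyShell d L μ Λ ↔ |torusBand L k - μ| ≤ Λ := by
  simp [torusEnergyShell]

/-- The `s`-wave (level-independent) form factor `ĝ ≡ 1`. von Delft–Ralph 2001, §4.2.1.
[folklore] -/
def sWaveGap (_k : TorusSite d L) : ℝ := 1

/-- The `d_{x²-y²}` form factor in momentum space, `ĝ_d(k) = cos k₁ - cos k₂` with `kᵢ = 2πκᵢ/L`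
(`latticeMomentum`). Scalapino, Phys. Rep. 250 (1995) 329, §2. [folklore] -/
def dWaveGap {L : ℕ} (k : TorusSite 2 L) : ℝ :=
  Real.cos (latticeMomentum L k 0) - Real.cos (latticeMomentum L k 1)

/-- **The reduced BCS (Richardson / pairing-force) Hamiltonian on the fermionic torus** with
chemical potential `μ`, form factor `ĝ`, interaction shell `S` and coupling `g`:
`H = Σ_{k,σ} (ε_L(k) - μ) n_{kσ} - (g / L^d) B(ĝ,S)† B(ĝ,S)`,
`B(ĝ,S) = Σ_{k∈S} ĝ(k) c_{-k↓} c_{k↑}`, i.e. the kinetic energy of ALL Bloch levels plus a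
separable pairing interaction `-(g/L^d) Σ_{k,k'∈S} ĝ(k)ĝ(k') c†_{k↑}c†_{-k↓}c_{-k'↓}c_{k'↑}` between
time-reversed pairs inside the shell. For `ĝ ≡ 1` this is von Delft–Ralph's
`Ĥ = Σ_{jσ}(ε_j - μ)c†_{jσ}c_{jσ} - λd Σ_{ij} c†_{i+}c†_{i-}c_{j-}c_{j+}` (§4.2.1, at `h = 0`) with
levels `j = k`, `ε_j = ε_L(k)`, `λd = g/L^d`; the kinetic term is literally the free torus Hubbard
Hamiltonian `hubbardTorusWith d L 1 0 μ` (`hubbardTorusWith_zero_eq_sum_momentumNumber`, `L ≥ 3`).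
It is Hermitian and conserves `N` and `S^z` (`isHermitian_reducedBCSTorus`,
`commute_totalNumber_reducedBCSTorus`, `commute_spinZ_reducedBCSTorus`).
[cite: VondelftRalph2001, §4.2.1] -/
def reducedBCSTorus (μ : ℝ) (ĝ : TorusSite d L → ℝ) (S : Finset (TorusSite d L)) (g : ℝ) :
    Matrix (Finset (Orb (FermionTorus d L))) (Finset (Orb (FermionTorus d L))) ℂ :=
  ∑ k : TorusSite d L, ∑ σ : Fin 2, ((torusBand L k - μ : ℝ) : ℂ) • momentumNumber k σ -
    ((g / (L : ℝ) ^ d : ℝ) : ℂ) • ((pairOperator ĝ S)ᴴ * pairOperator ĝ S)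

/-- `reducedBCSTorus` unfolded. [folklore] -/
theorem reducedBCSTorus_eq (μ : ℝ) (ĝ : TorusSite d L → ℝ) (S : Finset (TorusSite d L))
    (g : ℝ) :
    reducedBCSTorus μ ĝ S g =
      ∑ k : TorusSite d L, ∑ σ : Fin 2, ((torusBand L k - μ : ℝ) : ℂ) • momentumNumber k σ -
        ((g / (L : ℝ) ^ d : ℝ) : ℂ) • ((pairOperator ĝ S)ᴴ * pairOperator ĝ S) := rfl

/-- For `L ≥ 3` the kinetic part is the free grand-canonical torus Hubbard Hamiltonian:
`H_BCS = (H(1,0) - μN) - (g/L^d) B†B`. [folklore] -/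
theorem reducedBCSTorus_eq_hubbardTorusWith_sub (hL : 3 ≤ L) (μ : ℝ) (ĝ : TorusSite d L → ℝ)
    (S : Finset (TorusSite d L)) (g : ℝ) :
    reducedBCSTorus μ ĝ S g = hubbardTorusWith d L 1 0 μ -
      ((g / (L : ℝ) ^ d : ℝ) : ℂ) • ((pairOperator ĝ S)ᴴ * pairOperator ĝ S) := by
  rw [reducedBCSTorus, hubbardTorusWith_zero_eq_sum_momentumNumber hL]

/-- **`H_BCS` is Hermitian.** von Delft–Ralph 2001, §4.2.1. [folklore] -/
theorem isHermitian_reducedBCSTorus (μ : ℝ) (ĝ : TorusSite d L → ℝ) (S : Finset (TorusSite d L))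
    (g : ℝ) : (reducedBCSTorus μ ĝ S g).IsHermitian := by
  unfold Matrix.IsHermitian reducedBCSTorus
  simp only [conjTranspose_sub, conjTranspose_sum, conjTranspose_smul, conjTranspose_mul,
    conjTranspose_conjTranspose, momentumNumber_conjTranspose, Complex.star_def,
    Complex.conj_ofReal]

/-- `[Q_f, b_k] = -(f↓ + f↑) b_k`. [folklore] -/
theorem spinWeightedNumber_commutator_pairMode (f : Fin 2 → ℂ) (k : TorusSite d L) :
    spinWeightedNumber f * pairMode k - pairMode k * spinWeightedNumber f =
      -((f 1 + f 0) • pairMode k) := by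
  rw [pairMode, commutator_mul_expand, spinWeightedNumber_commutator_momentumAnnihilation,
    spinWeightedNumber_commutator_momentumAnnihilation, neg_mul, smul_mul_assoc, mul_neg,
    mul_smul_comm, add_smul, neg_add]

/-- `[Q_f, B(ĝ,S)] = -(f↓ + f↑) B(ĝ,S)`. [folklore] -/
theorem spinWeightedNumber_commutator_pairOperator (f : Fin 2 → ℂ) (ĝ : TorusSite d L → ℝ)
    (S : Finset (TorusSite d L)) :
    spinWeightedNumber f * pairOperator ĝ S - pairOperator ĝ S * spinWeightedNumber f =
      -((f 1 + f 0) • pairOperator ĝ S) := by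
  simp only [pairOperator, Finset.mul_sum, Finset.sum_mul, mul_smul_comm, smul_mul_assoc,
    ← Finset.sum_sub_distrib, ← smul_sub, spinWeightedNumber_commutator_pairMode, smul_neg,
    Finset.sum_neg_distrib, Finset.smul_sum, smul_comm (f 1 + f 0)]

/-- `[Q_f, B(ĝ,S)†] = (f↑ + f↓) B(ĝ,S)†`. [folklore] -/
theorem spinWeightedNumber_commutator_pairOperator_conjTranspose (f : Fin 2 → ℂ)
    (ĝ : TorusSite d L → ℝ) (S : Finset (TorusSite d L)) :
    spinWeightedNumber f * (pairOperator ĝ S)ᴴ - (pairOperator ĝ S)ᴴ * spinWeightedNumber f =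
      (f 0 + f 1) • (pairOperator ĝ S)ᴴ := by
  have hk : ∀ k : TorusSite d L,
      spinWeightedNumber f * (momentumCreation k 0 * momentumCreation (-k) 1) -
        momentumCreation k 0 * momentumCreation (-k) 1 * spinWeightedNumber f =
      (f 0 + f 1) • (momentumCreation k 0 * momentumCreation (-k) 1) := fun k => by
    rw [commutator_mul_expand, spinWeightedNumber_commutator_momentumCreation,
      spinWeightedNumber_commutator_momentumCreation, smul_mul_assoc, mul_smul_comm, add_smul]
  rw [pairOperator_conjTranspose]
  simp only [Finset.mul_sum, Finset.sum_mul, mul_smul_comm, smul_mul_assoc,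
    ← Finset.sum_sub_distrib, ← smul_sub, hk, Finset.smul_sum, smul_comm (f 0 + f 1)]

/-- **Every spin-weighted charge is conserved by `H_BCS`**: `[Q_f, H_BCS] = 0` (each `n_{kσ}`
commutes with `Q_f`, and `B†B` carries charge `(f↑ + f↓) - (f↑ + f↓) = 0`).
von Delft–Ralph 2001, §4.2.3 (`[Ĥ, N̂] = 0`). [folklore] -/
theorem spinWeightedNumber_commute_reducedBCSTorus (f : Fin 2 → ℂ) (μ : ℝ)
    (ĝ : TorusSite d L → ℝ) (S : Finset (TorusSite d L)) (g : ℝ) :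
    Commute (spinWeightedNumber f) (reducedBCSTorus μ ĝ S g) := by
  have hBB : spinWeightedNumber f * ((pairOperator ĝ S)ᴴ * pairOperator ĝ S) -
      (pairOperator ĝ S)ᴴ * pairOperator ĝ S * spinWeightedNumber f = 0 := by
    rw [commutator_mul_expand, spinWeightedNumber_commutator_pairOperator_conjTranspose,
      spinWeightedNumber_commutator_pairOperator, smul_mul_assoc, mul_neg, mul_smul_comm,
      add_comm (f 1) (f 0), add_neg_cancel]
  have hn : ∀ (k : TorusSite d L) (σ : Fin 2), spinWeightedNumber f * momentumNumber k σ -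
      momentumNumber k σ * spinWeightedNumber f = 0 := fun k σ =>
    sub_eq_zero.2 (spinWeightedNumber_commute_momentumNumber f k σ).eq
  rw [Commute, SemiconjBy, ← sub_eq_zero, reducedBCSTorus, Matrix.mul_sub, Matrix.sub_mul]
  simp only [Finset.mul_sum, Finset.sum_mul, mul_smul_comm, smul_mul_assoc]
  rw [sub_sub_sub_comm, ← Finset.sum_sub_distrib, ← smul_sub, hBB, smul_zero, sub_zero]
  refine Finset.sum_eq_zero fun k _ => ?_
  rw [← Finset.sum_sub_distrib]
  exact Finset.sum_eq_zero fun σ _ => by rw [← smul_sub, hn, smul_zero]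

/-- **`H_BCS` conserves the particle number**: `[N, H_BCS] = 0`. von Delft–Ralph 2001, §4.2.3.
[cite: VondelftRalph2001, §4.2.3] -/
theorem commute_totalNumber_reducedBCSTorus (μ : ℝ) (ĝ : TorusSite d L → ℝ)
    (S : Finset (TorusSite d L)) (g : ℝ) :
    Commute (totalNumber : Matrix _ _ ℂ) (reducedBCSTorus μ ĝ S g) := by
  rw [totalNumber_eq_spinWeightedNumber]
  exact spinWeightedNumber_commute_reducedBCSTorus _ μ ĝ S g

/-- **`H_BCS` conserves `S^z`**: `[S^z, H_BCS] = 0` (each pair `(k↑, -k↓)` has `S^z = 0`).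
von Delft–Ralph 2001, §4.2.3 (the pair Hamiltonian is `h`-independent). [folklore] -/
theorem commute_spinZ_reducedBCSTorus (μ : ℝ) (ĝ : TorusSite d L → ℝ)
    (S : Finset (TorusSite d L)) (g : ℝ) :
    Commute (HubbardWave0.spinZ : Matrix _ _ ℂ) (reducedBCSTorus μ ĝ S g) := by
  rw [spinZ_eq_spinWeightedNumber]
  exact spinWeightedNumber_commute_reducedBCSTorus _ μ ĝ S g

/-! ### Hard-core boson relations of the pair modes -/

/-- `b_k² = 0` (Pauli principle). von Delft–Ralph 2001, §4.2.3, first hard-core boson relation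
(there for `b†`). [cite: VondelftRalph2001, §4.2.3] -/
theorem pairMode_mul_self (k : TorusSite d L) : pairMode k * pairMode k = 0 := by
  have h0 : momentumAnnihilation k 0 * momentumAnnihilation k (0 : Fin 2) = 0 := by
    have h := momentumAnnihilation_anticomm k k (0 : Fin 2) 0
    rw [← two_smul ℂ] at h
    exact (smul_eq_zero.1 h).resolve_left two_ne_zero
  calc pairMode k * pairMode k
      = momentumAnnihilation (-k) 1 * (momentumAnnihilation k 0 * momentumAnnihilation (-k) 1) *
          momentumAnnihilation k 0 := by simp only [pairMode, Matrix.mul_assoc]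
    _ = 0 := by
          rw [momentumAnnihilation_mul_eq_neg k (-k) 0 1, mul_neg, neg_mul, Matrix.mul_assoc,
            Matrix.mul_assoc, h0, Matrix.mul_zero, Matrix.mul_zero, neg_zero]

/-- Pair modes commute: `b_k b_{k'} = b_{k'} b_k` (they are even in the fermions). [folklore] -/
theorem pairMode_comm (k k' : TorusSite d L) :
    pairMode k * pairMode k' = pairMode k' * pairMode k := by
  simp only [pairMode]
  set a := momentumAnnihilation (-k) (1 : Fin 2)
  set b := momentumAnnihilation k (0 : Fin 2)
  set c := momentumAnnihilation (-k') (1 : Fin 2)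
  set e := momentumAnnihilation k' (0 : Fin 2)
  have hbc : b * c = -(c * b) := momentumAnnihilation_mul_eq_neg _ _ _ _
  have hbe : b * e = -(e * b) := momentumAnnihilation_mul_eq_neg _ _ _ _
  have hac : a * c = -(c * a) := momentumAnnihilation_mul_eq_neg _ _ _ _
  have hae : a * e = -(e * a) := momentumAnnihilation_mul_eq_neg _ _ _ _
  calc a * b * (c * e) = a * (b * c) * e := by noncomm_ring
    _ = -(a * c) * (b * e) := by rw [hbc]; noncomm_ring
    _ = -(-(c * a)) * (-(e * b)) := by rw [hac, hbe]
    _ = -(c * (a * e) * b) := by noncomm_ring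
    _ = c * e * (a * b) := by rw [hae]; noncomm_ring

/-- **The hard-core boson commutator**: `[b_k, b†_{k'}] = δ_{kk'} (1 - n_{k↑} - n_{-k↓})` in the
full Fock space (on states without singly occupied pair levels `n_{k↑} + n_{-k↓} = 2 b†_k b_k`,
giving von Delft–Ralph's `δ_{jj'}(1 - 2b†_j b_j)`). von Delft–Ralph 2001, §4.2.3.
[cite: VondelftRalph2001, §4.2.3] -/
theorem pairMode_commutator_conjTranspose (k k' : TorusSite d L) :
    pairMode k * (pairMode k')ᴴ - (pairMode k')ᴴ * pairMode k =
      if k = k' then 1 - momentumNumber k 0 - momentumNumber (-k) 1 else 0 := by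
  rw [pairMode_conjTranspose, pairMode]
  have h11 : momentumAnnihilation k 0 * momentumCreation k' 0 =
      (if k = k' then 1 else 0) - momentumCreation k' 0 * momentumAnnihilation k 0 := by
    rw [momentumAnnihilation_mul_momentumCreation]; simp
  have h22 : momentumAnnihilation (-k) 1 * momentumCreation (-k') 1 =
      (if k = k' then 1 else 0) - momentumCreation (-k') 1 * momentumAnnihilation (-k) 1 := by
    rw [momentumAnnihilation_mul_momentumCreation]; simp [neg_inj]
  have h21 : momentumAnnihilation (-k) 1 * momentumCreation k' 0 =
      -(momentumCreation k' 0 * momentumAnnihilation (-k) 1) := by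
    rw [momentumAnnihilation_mul_momentumCreation]; simp
  have h12 : momentumAnnihilation k 0 * momentumCreation (-k') 1 =
      -(momentumCreation (-k') 1 * momentumAnnihilation k 0) := by
    rw [momentumAnnihilation_mul_momentumCreation]; simp
  have step : momentumAnnihilation (-k) 1 * momentumAnnihilation k 0 *
        (momentumCreation k' 0 * momentumCreation (-k') 1) =
      (if k = k' then 1 else 0) * (momentumAnnihilation (-k) 1 * momentumCreation (-k') 1) -
        momentumCreation k' 0 * (momentumAnnihilation (-k) 1 * momentumCreation (-k') 1) *
          momentumAnnihilation k 0 := by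
    calc momentumAnnihilation (-k) 1 * momentumAnnihilation k 0 *
          (momentumCreation k' 0 * momentumCreation (-k') 1)
        = momentumAnnihilation (-k) 1 * (momentumAnnihilation k 0 * momentumCreation k' 0) *
            momentumCreation (-k') 1 := by
          simp only [Matrix.mul_assoc]
      _ = momentumAnnihilation (-k) 1 * ((if k = k' then 1 else 0) -
            momentumCreation k' 0 * momentumAnnihilation k 0) * momentumCreation (-k') 1 := by
          rw [h11]
      _ = (if k = k' then 1 else 0) * (momentumAnnihilation (-k) 1 * momentumCreation (-k') 1) -
            (momentumAnnihilation (-k) 1 * momentumCreation k' 0) *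
              (momentumAnnihilation k 0 * momentumCreation (-k') 1) := by
          split_ifs <;> noncomm_ring
      _ = _ := by rw [h21, h12]; noncomm_ring
  rw [step, h22]
  split_ifs with hk
  · subst hk
    simp only [momentumNumber]
    noncomm_ring
  · simp only [Matrix.zero_mul, zero_sub]
    noncomm_ring

/-- `c†_{kσ} c†_{kσ} = 0` (Pauli principle in momentum space). [folklore] -/
theorem momentumCreation_mul_self (k : TorusSite d L) (σ : Fin 2) :
    momentumCreation k σ * momentumCreation k σ = 0 := by
  have h := momentumCreation_mul_eq_neg k k σ σ
  rw [eq_neg_iff_add_eq_zero, ← two_smul ℂ] at h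
  exact (smul_eq_zero.1 h).resolve_left two_ne_zero

/-- `[b†_k b_k, b†_{k'}] = δ_{kk'} b†_k`: the third hard-core boson relation, valid in the full
Fock space (`b†_k n_{k↑} = b†_k n_{-k↓} = 0`). von Delft–Ralph 2001, §4.2.3.
[cite: VondelftRalph2001, §4.2.3] -/
theorem pairNumber_commutator_conjTranspose (k k' : TorusSite d L) :
    (pairMode k)ᴴ * pairMode k * (pairMode k')ᴴ - (pairMode k')ᴴ * ((pairMode k)ᴴ * pairMode k) =
      if k = k' then (pairMode k)ᴴ else 0 := by
  have hcomm : (pairMode k')ᴴ * (pairMode k)ᴴ = (pairMode k)ᴴ * (pairMode k')ᴴ := by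
    rw [← conjTranspose_mul, ← conjTranspose_mul, pairMode_comm]
  have key : (pairMode k)ᴴ * pairMode k * (pairMode k')ᴴ -
      (pairMode k')ᴴ * ((pairMode k)ᴴ * pairMode k) =
      (pairMode k)ᴴ * (pairMode k * (pairMode k')ᴴ - (pairMode k')ᴴ * pairMode k) := by
    have h3 : (pairMode k')ᴴ * ((pairMode k)ᴴ * pairMode k) =
        (pairMode k)ᴴ * ((pairMode k')ᴴ * pairMode k) := by
      rw [← Matrix.mul_assoc, hcomm, Matrix.mul_assoc]
    rw [h3]
    noncomm_ring
  rw [key, pairMode_commutator_conjTranspose]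
  split_ifs with hk
  · subst hk
    have h1 : (pairMode k)ᴴ * momentumNumber k 0 = 0 := by
      rw [pairMode_conjTranspose, momentumNumber, momentumCreation_mul_eq_neg k (-k) 0 1, neg_mul,
        Matrix.mul_assoc, ← Matrix.mul_assoc (momentumCreation k 0) (momentumCreation k 0),
        momentumCreation_mul_self, Matrix.zero_mul, Matrix.mul_zero, neg_zero]
    have h2 : (pairMode k)ᴴ * momentumNumber (-k) 1 = 0 := by
      rw [pairMode_conjTranspose, momentumNumber, Matrix.mul_assoc,
        ← Matrix.mul_assoc (momentumCreation (-k) 1) (momentumCreation (-k) 1),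
        momentumCreation_mul_self, Matrix.zero_mul, Matrix.mul_zero]
    rw [Matrix.mul_sub, Matrix.mul_sub, Matrix.mul_one, h1, h2, sub_zero, sub_zero]
  · rw [Matrix.mul_zero]

/-! ### Richardson's exact solution of the level-independent model (statement) -/

/-- Richardson's pair Hamiltonian on the set `U` of unblocked levels with level energies `ε` and
pairing constant `G`: `Ĥ_U = Σ_{i,j∈U} (2ε_j δ_{ij} - G) b†_i b_j`. (On states without singly
occupied levels and with all pairs inside the shell `S`, `reducedBCSTorus μ sWaveGap S g` acts as
`Ĥ_U` with `U = S`, `ε = ε_L - μ` — an even function of `k`, so a pair `(k↑,-k↓)` costs `2ε_k` —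
and `G = g/L^d`; singly occupied (blocked) levels `B` drop out, `U = S ∖ B`: von Delft–Ralph 2001
§4.2.3. This reduction is not formalised here.)
von Delft–Ralph 2001, §4.2.3 and §5.1.1. [cite: VondelftRalph2001, §5.1.1] -/
def richardsonHamiltonian (ε : TorusSite d L → ℝ) (U : Finset (TorusSite d L)) (G : ℝ) :
    Matrix (Finset (Orb (FermionTorus d L))) (Finset (Orb (FermionTorus d L))) ℂ :=
  ∑ j ∈ U, ((2 * ε j : ℝ) : ℂ) • ((pairMode j)ᴴ * pairMode j) -
    (G : ℂ) • ((∑ i ∈ U, (pairMode i)ᴴ) * ∑ j ∈ U, pairMode j)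

/-- Richardson's generalised pair creator `B†(E) = Σ_{j∈U} b†_j / (2ε_j - E)`.
von Delft–Ralph 2001, §5.1.1. [cite: VondelftRalph2001, §5.1.1] -/
def richardsonPairCreator (ε : TorusSite d L → ℝ) (U : Finset (TorusSite d L)) (E : ℂ) :
    Matrix (Finset (Orb (FermionTorus d L))) (Finset (Orb (FermionTorus d L))) ℂ :=
  ∑ j ∈ U, (((2 * ε j : ℝ) : ℂ) - E)⁻¹ • (pairMode j)ᴴ

/-- **Richardson's equations** for `n` pair energies `E_1, …, E_n ∈ ℂ`:
the `E_ν` are pairwise distinct, avoid the poles `2ε_j` (`j ∈ U`), and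
`1/G - Σ_{j∈U} 1/(2ε_j - E_ν) + Σ_{μ≠ν} 2/(E_μ - E_ν) = 0` for every `ν`.
Richardson, Phys. Lett. 3 (1963) 277; von Delft–Ralph 2001, §5.1.1.
[cite: VondelftRalph2001, §5.1.1] -/
def IsRichardsonSolution (ε : TorusSite d L → ℝ) (U : Finset (TorusSite d L)) (G : ℝ) {n : ℕ}
    (E : Fin n → ℂ) : Prop :=
  Function.Injective E ∧ (∀ ν, ∀ j ∈ U, ((2 * ε j : ℝ) : ℂ) ≠ E ν) ∧
    ∀ ν, (G : ℂ)⁻¹ - ∑ j ∈ U, (((2 * ε j : ℝ) : ℂ) - E ν)⁻¹ +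
      ∑ μ ∈ univ.erase ν, 2 * (E μ - E ν)⁻¹ = 0

/-- **Richardson's exact eigenstates of the reduced BCS model** (named fact, statement only).
For level energies `ε`, unblocked levels `U`, coupling `G ≠ 0` and every solution `(E_ν)_{ν<n}`
of Richardson's equations (`IsRichardsonSolution`), the state `Π_ν B†(E_ν) |0⟩`,
`B†(E) = Σ_{j∈U} b†_j/(2ε_j - E)`, satisfies the eigenvalue equation
`Ĥ_U Ψ = (Σ_ν E_ν) Ψ` for `Ĥ_U = Σ_{i,j∈U}(2ε_jδ_{ij} - G) b†_i b_j` (the identity holds in the full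
Fock space; it is proved by commuting `Ĥ_U` past the `B†_ν`, von Delft–Ralph App. B).
Non-vanishing of `Ψ` and completeness of these states for distinct `ε_j` (Gaudin) are NOT part of
this statement. Richardson, Phys. Lett. 3 (1963) 277–279; von Delft–Ralph, Phys. Rep. 345 (2001)
61, §5.1.1. [cite: VondelftRalph2001, §5.1.1] -/
def richardson_exact_eigenstates (d L : ℕ) [NeZero L] : Prop :=
  ∀ (ε : TorusSite d L → ℝ) (U : Finset (TorusSite d L)) (G : ℝ), G ≠ 0 →
    ∀ (n : ℕ) (E : Fin n → ℂ), IsRichardsonSolution ε U G E →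
      richardsonHamiltonian ε U G *ᵥ
          ((List.ofFn fun ν => richardsonPairCreator ε U (E ν)).prod *ᵥ vacuum) =
        (∑ ν, E ν) • ((List.ofFn fun ν => richardsonPairCreator ε U (E ν)).prod *ᵥ vacuum)

end BCS

end Literature.MathematicalPhysics.QuantumLattice
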